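import Literature.MathematicalPhysics.QuantumManyBody.DyadicCoherentFraction
import HarnessLib

/-!
# Dyadic coherent fraction: refinement monotonicity and the Bessel bound

Topic `Literature/MathematicalPhysics/QuantumManyBody`; companion of `DyadicCoherentFraction.lean`
(definition item `defn-DyadicCoherentFraction`, route `BECTangentStates` of
`Summits/AtomisticToContinuum/BoseEinsteinCondensation`), supplying the two structural properties of the
dyadic coherent sum `cohSum N L k Ψ = ∑_m ⟨dyMode L k m, γ_Ψ dyMode L k m⟩` that make
`F_k(Ψ) = cohSum / N` a monotone, `[0,1]`-valued, scale-resolved order parameter.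

* `dyChild m c = 2m + c` — the index at level `k+1` of the child `c ∈ {0,1}³` of the cell `m` of level `k`;
  `dyChild_injective2`; `dyCell_eq_iUnion_dyChild` (the eight half-open children partition the parent
  exactly); `setIntegral_dyCell_eq_sum_dyChild`.
* `occupation_dyMode_le_sum_dyChild`: for a measurable `N`-body wave function the occupation of the flat
  mode of a cell is at most the sum of the occupations of its children's flat modes — the parent mode is
  `8^{-1/2} ∑ children` and `|∑_{c ≤ 8} A_c|² ≤ 8 ∑ |A_c|²` (Cauchy–Schwarz) inside the `Y`-integral of
  `occupation`, the finite sum commuting with `∫⁻` by measurability of the parametric cell integrals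
  (`measurable_setIntegral_vecCons`, Fubini).
* `cohSum_le_cohSum_succ`, `monotone_cohSum`: **refinement monotonicity** `cohSum N L k Ψ ≤ cohSum N L (k+1) Ψ`
  for measurable `Ψ`, and `cohSum_le_cohSum_succ_trialState` for admissible (`C¹`) trial states — the
  statement of item `DyadicMonotone` (`stmt-AtomisticToContinuum-6420`) up to unfolding `cohSum`/`dyMode`/`dyCell`.
* `cohSum_le_mul_lintegral`: **Bessel bound** `cohSum N L k Ψ ≤ N ∫ |Ψ|²` for measurable `Ψ` (Cauchy–Schwarz
  `|∫_C f|² ≤ |C| ∫_C |f|²` on each cell, `nnnorm_integral_sq_le_mul_lintegral`; disjointness of the cells;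
  Tonelli over the first particle, `lintegral_nnnorm_sq_eq_lintegral_vecCons`), hence `cohSum_le_card`:
  `cohSum N L k Ψ ≤ N` for admissible trial states, i.e. `F_k ∈ [0, 1]`.

All [folklore]. Measurability of `Ψ` is needed throughout: for non-measurable `Ψ` the lower Lebesgue
integral is only superadditive and both inequalities can fail. Not here: `cohSum N L k Ψ → N` as `k → ∞`
for a fixed `C¹` state (Lebesgue differentiation along the dyadic filtration).

## References

* [LSSY2005] E. H. Lieb, R. Seiringer, J. P. Solovej, J. Yngvason, *The Mathematics of the Bose Gas and
  its Condensation*, Birkhäuser 2005, §1.2 (1.17) (occupation / one-particle density matrix; `tr γ = N`).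
-/

noncomputable section

open MeasureTheory Filter Metric WithLp
open scoped ENNReal NNReal ComplexConjugate

namespace Literature.MathematicalPhysics.QuantumManyBody.BoseGas

/-! ### Children of a dyadic cell and refinement monotonicity -/

section Refinement

variable {L : ℝ} {k : ℕ}

/-- The index `2m + c` at level `k+1` of the child `c ∈ {0,1}³` of the cell `m` of level `k`. [folklore] -/
def dyChild (m : Fin 3 → Fin (2 ^ k)) (c : Fin 3 → Fin 2) : Fin 3 → Fin (2 ^ (k + 1)) :=
  fun j => ⟨2 * (m j : ℕ) + (c j : ℕ), by
    have h1 := (m j).isLt; have h2 := (c j).isLt; rw [pow_succ]; omega⟩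

/-- Coordinates of a child index. [folklore] -/
@[simp]
theorem dyChild_apply (m : Fin 3 → Fin (2 ^ k)) (c : Fin 3 → Fin 2) (j : Fin 3) :
    ((dyChild m c j : ℕ)) = 2 * (m j : ℕ) + (c j : ℕ) :=
  rfl

/-- `(m, c) ↦ 2m + c` is injective (a bijection onto the indices of level `k+1`, by counting). [folklore] -/
theorem dyChild_injective2 :
    Function.Injective fun p : (Fin 3 → Fin (2 ^ k)) × (Fin 3 → Fin 2) => dyChild p.1 p.2 := by
  rintro ⟨m, c⟩ ⟨m', c'⟩ h
  dsimp only at h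
  have hj : ∀ j, 2 * (m j : ℕ) + (c j : ℕ) = 2 * (m' j : ℕ) + (c' j : ℕ) := fun j => by
    have := congrArg (fun q : Fin 3 → Fin (2 ^ (k + 1)) => ((q j : ℕ))) h
    simpa only [dyChild_apply] using this
  have hc : ∀ j, (c j : ℕ) < 2 := fun j => (c j).isLt
  have hc' : ∀ j, (c' j : ℕ) < 2 := fun j => (c' j).isLt
  refine Prod.ext (funext fun j => Fin.ext ?_) (funext fun j => Fin.ext ?_) <;> dsimp only <;>
    · have := hj j; have := hc j; have := hc' j; omega

/-- For fixed parent, `c ↦ dyChild m c` is injective. [folklore] -/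
theorem dyChild_injective (m : Fin 3 → Fin (2 ^ k)) : Function.Injective (dyChild m) :=
  fun _ _ h => congrArg Prod.snd (dyChild_injective2 (a₁ := (m, _)) (a₂ := (m, _)) h)

/-- The side of level `k+1` is half the side of level `k`. [folklore] -/
theorem side_succ (L : ℝ) (k : ℕ) : L / 2 ^ (k + 1) = L / 2 ^ k / 2 := by
  rw [pow_succ, div_div]

/-- Every child cell lies in its parent. [folklore] -/
theorem dyCell_dyChild_subset (m : Fin 3 → Fin (2 ^ k)) (c : Fin 3 → Fin 2) :
    dyCell L (k + 1) (dyChild m c) ⊆ dyCell L k m := by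
  intro x hx j
  obtain ⟨h1, h2⟩ := hx j
  simp only [dyChild_apply, Nat.cast_add, Nat.cast_mul, Nat.cast_ofNat, side_succ] at h1 h2
  have hc : ((c j : ℕ) : ℝ) ≤ 1 := by exact_mod_cast Nat.lt_succ_iff.1 (c j).isLt
  have hc0 : (0 : ℝ) ≤ ((c j : ℕ) : ℝ) := Nat.cast_nonneg _
  rcases le_or_gt 0 L with hL | hL
  · have hs : 0 ≤ L / 2 ^ k / 2 := by positivity
    constructor <;> nlinarith
  · exfalso
    have hs : L / 2 ^ k / 2 < 0 := by
      have : L / 2 ^ k < 0 := div_neg_of_neg_of_pos hL (by positivity)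
      linarith
    nlinarith

/-- Every point of a parent cell lies in one of its eight children. [folklore] -/
theorem dyCell_subset_iUnion_dyChild (m : Fin 3 → Fin (2 ^ k)) :
    dyCell L k m ⊆ ⋃ c, dyCell L (k + 1) (dyChild m c) := by
  intro x hx
  have h1 : x ∈ ⋃ m, dyCell L k m := Set.mem_iUnion.2 ⟨m, hx⟩
  rw [iUnion_dyCell, ← iUnion_dyCell L (k + 1)] at h1
  obtain ⟨m', hm'⟩ := Set.mem_iUnion.1 h1
  have hs : 0 < L / 2 ^ k := by
    obtain ⟨h0, h0'⟩ := hx 0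
    nlinarith
  have hbounds : ∀ j, 2 * (m j : ℕ) ≤ (m' j : ℕ) ∧ (m' j : ℕ) ≤ 2 * (m j : ℕ) + 1 := by
    intro j
    obtain ⟨h0, h0'⟩ := hx j
    obtain ⟨h1, h1'⟩ := hm' j
    rw [side_succ] at h1 h1'
    have e1 : ((m' j : ℕ) : ℝ) < 2 * (m j : ℕ) + 2 := by nlinarith
    have e2 : (2 : ℝ) * (m j : ℕ) < (m' j : ℕ) + 1 := by nlinarith
    constructor
    · exact_mod_cast Nat.lt_succ_iff.1 (by exact_mod_cast e2 : 2 * (m j : ℕ) < (m' j : ℕ) + 1)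
    · exact_mod_cast Nat.lt_succ_iff.1 (by exact_mod_cast e1 : (m' j : ℕ) < 2 * (m j : ℕ) + 1 + 1)
  let c : Fin 3 → Fin 2 := fun j => ⟨(m' j : ℕ) - 2 * (m j : ℕ), by have := hbounds j; omega⟩
  have hc : dyChild m c = m' := funext fun j => Fin.ext (by
    have := hbounds j; simp only [dyChild_apply, c]; omega)
  exact Set.mem_iUnion.2 ⟨c, hc ▸ hm'⟩

/-- **Children partition the parent** (as sets; disjointness is `disjoint_dyCell` with
`dyChild_injective`). [folklore] -/
theorem dyCell_eq_iUnion_dyChild (m : Fin 3 → Fin (2 ^ k)) :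
    dyCell L k m = ⋃ c, dyCell L (k + 1) (dyChild m c) :=
  Set.Subset.antisymm (dyCell_subset_iUnion_dyChild m)
    (Set.iUnion_subset fun c => dyCell_dyChild_subset m c)

/-- The integral over a parent cell is the sum of the integrals over its children (for a function
integrable on the parent). [folklore] -/
theorem setIntegral_dyCell_eq_sum_dyChild (m : Fin 3 → Fin (2 ^ k)) {f : Space → ℂ}
    (hf : IntegrableOn f (dyCell L k m)) :
    ∫ x in dyCell L k m, f x = ∑ c, ∫ x in dyCell L (k + 1) (dyChild m c), f x := by
  rw [dyCell_eq_iUnion_dyChild m]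
  exact integral_iUnion_fintype (fun c => measurableSet_dyCell L (k + 1) _)
    (fun c c' h => disjoint_dyCell ((dyChild_injective m).ne h))
    (fun c => hf.mono_set (dyCell_dyChild_subset m c))

/-- Cauchy–Schwarz bookkeeping: if `card ι · a² = a'²` then `‖a ∑_c I_c‖² ≤ ∑_c ‖a' I_c‖²`. [folklore] -/
theorem norm_mul_sum_sq_le {ι : Type*} [Fintype ι] (I : ι → ℂ) {a a' : ℝ} (ha : 0 ≤ a)
    (h : (Fintype.card ι : ℝ) * a ^ 2 = a' ^ 2) :
    ‖(a : ℂ) * ∑ c, I c‖ ^ 2 ≤ ∑ c, ‖(a' : ℂ) * I c‖ ^ 2 := by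
  have hS : ‖∑ c, I c‖ ^ 2 ≤ (Fintype.card ι : ℝ) * ∑ c, ‖I c‖ ^ 2 :=
    calc ‖∑ c, I c‖ ^ 2 ≤ (∑ c, ‖I c‖) ^ 2 := by gcongr; exact norm_sum_le _ _
      _ ≤ (Finset.univ.card : ℝ) * ∑ c, ‖I c‖ ^ 2 := sq_sum_le_card_mul_sum_sq
      _ = _ := by rw [Finset.card_univ]
  calc ‖(a : ℂ) * ∑ c, I c‖ ^ 2 = a ^ 2 * ‖∑ c, I c‖ ^ 2 := by
        rw [norm_mul, Complex.norm_real, Real.norm_of_nonneg ha, mul_pow]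
    _ ≤ a ^ 2 * ((Fintype.card ι : ℝ) * ∑ c, ‖I c‖ ^ 2) := by gcongr
    _ = a' ^ 2 * ∑ c, ‖I c‖ ^ 2 := by rw [← mul_assoc, mul_comm (a ^ 2), h]
    _ = ∑ c, ‖(a' : ℂ) * I c‖ ^ 2 := by
        rw [Finset.mul_sum]
        refine Finset.sum_congr rfl fun c _ => ?_
        rw [norm_mul, Complex.norm_real, mul_pow, Real.norm_eq_abs, sq_abs]

/-- `(Y, x) ↦ (x, Y)` (prepend a particle) is measurable. [folklore] -/
theorem measurable_vecCons_snd_fst (n : ℕ) :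
    Measurable fun p : Config n × Space => (Matrix.vecCons p.2 p.1 : Config (n + 1)) :=
  measurable_pi_lambda _ fun j => Fin.cases (by simpa using measurable_snd)
    (fun i => by simpa using measurable_fst.eval) j

/-- Parametric cell integrals `Y ↦ ∫_C Ψ(x, Y) dx` of a measurable `Ψ` are measurable (Fubini).
[folklore] -/
theorem measurable_setIntegral_vecCons {n : ℕ} {Ψ : Config (n + 1) → ℂ} (hΨ : Measurable Ψ)
    (C : Set Space) : Measurable fun Y : Config n => ∫ x in C, Ψ (Matrix.vecCons x Y) := by
  have h : StronglyMeasurable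
      (Function.uncurry fun (Y : Config n) (x : Space) => Ψ (Matrix.vecCons x Y)) :=
    (hΨ.comp (measurable_vecCons_snd_fst n)).stronglyMeasurable
  exact (h.integral_prod_right' (ν := volume.restrict C)).measurable

/-- Unfolding `occupation` for `N = n + 1` particles. [cite: LSSY2005, §1.2 (1.17)] -/
theorem occupation_succ (n : ℕ) (φ : Space → ℂ) (Ψ : Config (n + 1) → ℂ) :
    occupation (n + 1) φ Ψ = (n + 1 : ℝ≥0∞) *
      ∫⁻ Y : Config n, (‖∫ x, conj (φ x) * Ψ (Matrix.vecCons x Y)‖₊ : ℝ≥0∞) ^ 2 :=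
  rfl

/-- `(‖z‖₊ : ℝ≥0∞)² = ofReal ‖z‖²`. [folklore] -/
theorem nnnorm_coe_sq_eq_ofReal (z : ℂ) : ((‖z‖₊ : ℝ≥0∞) ^ 2) = ENNReal.ofReal (‖z‖ ^ 2) := by
  rw [← ENNReal.coe_pow, ← ENNReal.ofReal_coe_nnreal, NNReal.coe_pow, coe_nnnorm]

/-- **One parent against its eight children.** For measurable `Ψ`, the occupation of the flat mode of
a cell is at most the sum of the occupations of the flat modes of its children: the parent mode is
`8^{-1/2} ∑ children` and `|∑_{c ≤ 8} A_c|² ≤ 8 ∑ |A_c|²` inside the `Y`-integral. [folklore] -/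
theorem occupation_dyMode_le_sum_dyChild {n : ℕ} (L : ℝ) (k : ℕ) (m : Fin 3 → Fin (2 ^ k))
    {Ψ : Config (n + 1) → ℂ} (hΨ : Measurable Ψ) :
    occupation (n + 1) (dyMode L k m) Ψ ≤
      ∑ c : Fin 3 → Fin 2, occupation (n + 1) (dyMode L (k + 1) (dyChild m c)) Ψ := by
  rcases le_or_gt L 0 with hL | hL
  · have h0 : dyMode L k m = fun _ => 0 := by
      rw [dyMode, dyCell_eq_empty hL, Set.indicator_empty]
    simp [occupation_succ, h0]
  have hr0 : 0 < L / 2 ^ k := by positivity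
  simp only [occupation_succ, integral_conj_dyMode_mul, side_succ L k]
  rw [← Finset.mul_sum]
  refine mul_le_mul_right (le_trans (lintegral_mono fun Y => ?_)
    (lintegral_finsetSum Finset.univ fun c _ => ?_).le) _
  swap
  · exact (((measurable_setIntegral_vecCons hΨ _).const_mul _).nnnorm.coe_nnreal_ennreal.pow_const 2)
  simp only [nnnorm_coe_sq_eq_ofReal]
  rw [← ENNReal.ofReal_sum_of_nonneg (fun c _ => by positivity)]
  refine ENNReal.ofReal_le_ofReal ?_
  simp_rw [← Complex.ofReal_inv]
  by_cases hint : IntegrableOn (fun x => Ψ (Matrix.vecCons x Y)) (dyCell L k m)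
  · rw [setIntegral_dyCell_eq_sum_dyChild m hint]
    refine norm_mul_sum_sq_le _ (by positivity) ?_
    have hcard : (Fintype.card (Fin 3 → Fin 2) : ℝ) = 8 := by simp
    rw [hcard, inv_pow, inv_pow, Real.sq_sqrt (by positivity), Real.sq_sqrt (by positivity)]
    field_simp
    ring
  · rw [integral_undef hint, mul_zero, norm_zero, zero_pow two_ne_zero]
    positivity

/-- **Refinement monotonicity of the dyadic coherent sum.** For a measurable `N`-body wave function,
`cohSum N L k Ψ ≤ cohSum N L (k+1) Ψ`: `F_k(Ψ)` is non-decreasing in the dyadic level. [folklore] -/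
theorem cohSum_le_cohSum_succ (L : ℝ) (k : ℕ) {N : ℕ} {Ψ : Config N → ℂ} (hΨ : Measurable Ψ) :
    cohSum N L k Ψ ≤ cohSum N L (k + 1) Ψ := by
  cases N with
  | zero => simp
  | succ n =>
    calc cohSum (n + 1) L k Ψ
        ≤ ∑ m : Fin 3 → Fin (2 ^ k), ∑ c : Fin 3 → Fin 2,
            occupation (n + 1) (dyMode L (k + 1) (dyChild m c)) Ψ :=
          Finset.sum_le_sum fun m _ => occupation_dyMode_le_sum_dyChild L k m hΨ
      _ = ∑ q ∈ (Finset.univ.image fun p : (Fin 3 → Fin (2 ^ k)) × (Fin 3 → Fin 2) => dyChild p.1 p.2),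
            occupation (n + 1) (dyMode L (k + 1) q) Ψ := by
          rw [Finset.sum_image fun p _ q _ h => dyChild_injective2 h, ← Finset.univ_product_univ,
            Finset.sum_product]
      _ ≤ cohSum (n + 1) L (k + 1) Ψ := Finset.sum_le_sum_of_subset (Finset.subset_univ _)

/-- Refinement monotonicity for admissible trial states (which are `C¹`, hence measurable); this is
item `DyadicMonotone` of route `BECTangentStates` for `L' = L`. [folklore] -/
theorem cohSum_le_cohSum_succ_trialState (L : ℝ) (k : ℕ) {N : ℕ} {L' : ℝ} (Ψ : TrialState N L') :
    cohSum N L k Ψ.ψ ≤ cohSum N L (k + 1) Ψ.ψ :=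
  cohSum_le_cohSum_succ L k Ψ.contDiff.continuous.measurable

/-- `k ↦ cohSum N L k Ψ` is monotone for measurable `Ψ`. [folklore] -/
theorem monotone_cohSum (N : ℕ) (L : ℝ) {Ψ : Config N → ℂ} (hΨ : Measurable Ψ) :
    Monotone fun k => cohSum N L k Ψ :=
  monotone_nat_of_le_succ fun k => cohSum_le_cohSum_succ L k hΨ

end Refinement

/-! ### The Bessel bound `cohSum ≤ N` -/

section Bessel

variable {L : ℝ}

/-- `‖(s³)^{-1/2}‖² = (s³)⁻¹` in `ℝ≥0∞` (`s > 0`). [folklore] -/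
theorem nnnorm_flatAmp_sq {s : ℝ} (hs : 0 < s) :
    ((‖((Real.sqrt (s ^ 3))⁻¹ : ℂ)‖₊ : ℝ≥0∞) ^ 2) = ENNReal.ofReal ((s ^ 3)⁻¹) := by
  have hs3 : 0 < s ^ 3 := by positivity
  rw [← ENNReal.coe_pow, ENNReal.ofReal, ENNReal.coe_inj]
  ext
  rw [NNReal.coe_pow, coe_nnnorm, norm_inv, Complex.norm_real, Real.norm_of_nonneg (Real.sqrt_nonneg _),
    inv_pow, Real.sq_sqrt hs3.le, Real.coe_toNNReal _ (by positivity)]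

/-- **Cauchy–Schwarz against the constant function**: `‖∫ f dμ‖² ≤ μ(univ) ∫ ‖f‖² dμ` for an a.e.
measurable `f` (Hölder with exponents `2, 2`; no integrability needed). [folklore] -/
theorem nnnorm_integral_sq_le_mul_lintegral {α : Type*} [MeasurableSpace α] (μ : Measure α) {f : α → ℂ}
    (hf : AEMeasurable f μ) :
    (‖∫ x, f x ∂μ‖₊ : ℝ≥0∞) ^ 2 ≤ μ Set.univ * ∫⁻ x, (‖f x‖₊ : ℝ≥0∞) ^ 2 ∂μ := by
  have hmeas : AEMeasurable (fun x => (‖f x‖₊ : ℝ≥0∞)) μ := hf.nnnorm.coe_nnreal_ennreal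
  have h := ENNReal.lintegral_mul_le_Lp_mul_Lq μ Real.HolderConjugate.two_two hmeas
    (g := fun _ => 1) aemeasurable_const
  simp only [Pi.mul_apply, mul_one, lintegral_const, ENNReal.rpow_two, one_pow, one_mul] at h
  calc (‖∫ x, f x ∂μ‖₊ : ℝ≥0∞) ^ 2 ≤ (∫⁻ x, (‖f x‖₊ : ℝ≥0∞) ∂μ) ^ 2 := by
        gcongr; exact enorm_integral_le_lintegral_enorm _
    _ ≤ ((∫⁻ x, (‖f x‖₊ : ℝ≥0∞) ^ 2 ∂μ) ^ (1 / 2 : ℝ) * μ Set.univ ^ (1 / 2 : ℝ)) ^ 2 := by gcongr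
    _ = μ Set.univ * ∫⁻ x, (‖f x‖₊ : ℝ≥0∞) ^ 2 ∂μ := by
        rw [← ENNReal.mul_rpow_of_nonneg _ _ (by norm_num : (0 : ℝ) ≤ 1 / 2), ← ENNReal.rpow_two,
          ← ENNReal.rpow_mul]
        norm_num [mul_comm]

/-- `(x, Y) ↦ (x, Y)` (prepend a particle, particle first) is measurable. [folklore] -/
theorem measurable_vecCons_fst_snd (n : ℕ) :
    Measurable fun p : Space × Config n => (Matrix.vecCons p.1 p.2 : Config (n + 1)) :=
  (measurable_vecCons_snd_fst n).comp measurable_swap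

/-- **Tonelli over the first particle**: `∫ |Ψ|² dX = ∫ (∫ |Ψ(x, Y)|² dx) dY`. [folklore] -/
theorem lintegral_nnnorm_sq_eq_lintegral_vecCons {n : ℕ} {Ψ : Config (n + 1) → ℂ} (hΨ : Measurable Ψ) :
    ∫⁻ X, (‖Ψ X‖₊ : ℝ≥0∞) ^ 2 =
      ∫⁻ Y : Config n, ∫⁻ x : Space, (‖Ψ (Matrix.vecCons x Y)‖₊ : ℝ≥0∞) ^ 2 := by
  have hmp := (measurePreserving_piFinSuccAbove
    (fun _ : Fin (n + 1) => (volume : Measure Space)) 0).symm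
  have he : ∀ p : Space × Config n,
      (MeasurableEquiv.piFinSuccAbove (fun _ : Fin (n + 1) => Space) 0).symm p =
        Matrix.vecCons p.1 p.2 := fun p => Fin.insertNth_zero' p.1 p.2
  have hG : Measurable fun p : Space × Config n => (‖Ψ (Matrix.vecCons p.1 p.2)‖₊ : ℝ≥0∞) ^ 2 :=
    ((hΨ.comp (measurable_vecCons_fst_snd n)).nnnorm.coe_nnreal_ennreal).pow_const 2
  calc ∫⁻ X, (‖Ψ X‖₊ : ℝ≥0∞) ^ 2
      = ∫⁻ p : Space × Config n, (‖Ψ ((MeasurableEquiv.piFinSuccAbove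
          (fun _ : Fin (n + 1) => Space) 0).symm p)‖₊ : ℝ≥0∞) ^ 2 ∂(volume.prod volume) :=
        (hmp.lintegral_comp_emb (MeasurableEquiv.measurableEmbedding _)
          (fun X => (‖Ψ X‖₊ : ℝ≥0∞) ^ 2)).symm
    _ = ∫⁻ p : Space × Config n, (‖Ψ (Matrix.vecCons p.1 p.2)‖₊ : ℝ≥0∞) ^ 2 ∂(volume.prod volume) := by
        simp only [he]
    _ = ∫⁻ Y : Config n, ∫⁻ x : Space, (‖Ψ (Matrix.vecCons x Y)‖₊ : ℝ≥0∞) ^ 2 :=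
        lintegral_prod_symm _ hG.aemeasurable

/-- Per slice `Y`, the normalised cell averages of `x ↦ Ψ(x, Y)` are dominated by its `L²` mass:
`∑_m (s³)⁻¹ |∫_{C_m} Ψ(x,Y) dx|² ≤ ∫ |Ψ(x,Y)|² dx` (Cauchy–Schwarz on each cell, cells disjoint). [folklore] -/
theorem sum_nnnorm_cellAverage_sq_le {n : ℕ} (hL : 0 < L) (k : ℕ) {Ψ : Config (n + 1) → ℂ}
    (hΨ : Measurable Ψ) (Y : Config n) :
    ∑ m : Fin 3 → Fin (2 ^ k), ((‖((Real.sqrt ((L / 2 ^ k) ^ 3))⁻¹ : ℂ) *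
        ∫ x in dyCell L k m, Ψ (Matrix.vecCons x Y)‖₊ : ℝ≥0∞) ^ 2) ≤
      ∫⁻ x, (‖Ψ (Matrix.vecCons x Y)‖₊ : ℝ≥0∞) ^ 2 := by
  have hs : 0 < L / 2 ^ k := by positivity
  have hmeasY : Measurable fun x : Space => Ψ (Matrix.vecCons x Y) :=
    hΨ.comp ((measurable_vecCons_fst_snd n).comp (measurable_id.prodMk measurable_const))
  have hcell : ∀ m : Fin 3 → Fin (2 ^ k), ((‖((Real.sqrt ((L / 2 ^ k) ^ 3))⁻¹ : ℂ) *
      ∫ x in dyCell L k m, Ψ (Matrix.vecCons x Y)‖₊ : ℝ≥0∞) ^ 2) ≤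
        ∫⁻ x in dyCell L k m, (‖Ψ (Matrix.vecCons x Y)‖₊ : ℝ≥0∞) ^ 2 := by
    intro m
    rw [nnnorm_mul, ENNReal.coe_mul, mul_pow, nnnorm_flatAmp_sq hs]
    calc ENNReal.ofReal (((L / 2 ^ k) ^ 3)⁻¹) *
          ((‖∫ x in dyCell L k m, Ψ (Matrix.vecCons x Y)‖₊ : ℝ≥0∞) ^ 2)
        ≤ ENNReal.ofReal (((L / 2 ^ k) ^ 3)⁻¹) * (volume (dyCell L k m) *
            ∫⁻ x in dyCell L k m, (‖Ψ (Matrix.vecCons x Y)‖₊ : ℝ≥0∞) ^ 2) := by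
          gcongr
          simpa only [Measure.restrict_apply_univ] using
            nnnorm_integral_sq_le_mul_lintegral (volume.restrict (dyCell L k m)) hmeasY.aemeasurable
      _ = ∫⁻ x in dyCell L k m, (‖Ψ (Matrix.vecCons x Y)‖₊ : ℝ≥0∞) ^ 2 := by
          rw [volume_dyCell, ← mul_assoc, ← ENNReal.ofReal_pow hs.le, ← ENNReal.ofReal_mul (by positivity),
            inv_mul_cancel₀ (by positivity), ENNReal.ofReal_one, one_mul]
  calc ∑ m : Fin 3 → Fin (2 ^ k), ((‖((Real.sqrt ((L / 2 ^ k) ^ 3))⁻¹ : ℂ) *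
        ∫ x in dyCell L k m, Ψ (Matrix.vecCons x Y)‖₊ : ℝ≥0∞) ^ 2)
      ≤ ∑ m : Fin 3 → Fin (2 ^ k), ∫⁻ x in dyCell L k m, (‖Ψ (Matrix.vecCons x Y)‖₊ : ℝ≥0∞) ^ 2 :=
        Finset.sum_le_sum fun m _ => hcell m
    _ = ∫⁻ x in ⋃ m ∈ (Finset.univ : Finset (Fin 3 → Fin (2 ^ k))), dyCell L k m,
          (‖Ψ (Matrix.vecCons x Y)‖₊ : ℝ≥0∞) ^ 2 :=
        (lintegral_biUnion_finset (fun m _ m' _ h => disjoint_dyCell h)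
          (fun m _ => measurableSet_dyCell L k m) _).symm
    _ ≤ ∫⁻ x, (‖Ψ (Matrix.vecCons x Y)‖₊ : ℝ≥0∞) ^ 2 := setLIntegral_le_lintegral _ _

/-- **Bessel bound for the dyadic coherent sum.** For a measurable `N`-body wave function,
`cohSum N L k Ψ ≤ N ∫ |Ψ|²`: the flat modes of one level are orthonormal, so the total occupation of
their span is at most `tr γ_Ψ = N ‖Ψ‖²`. [folklore] -/
theorem cohSum_le_mul_lintegral (L : ℝ) (k : ℕ) {N : ℕ} {Ψ : Config N → ℂ} (hΨ : Measurable Ψ) :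
    cohSum N L k Ψ ≤ N * ∫⁻ X, (‖Ψ X‖₊ : ℝ≥0∞) ^ 2 := by
  cases N with
  | zero => simp
  | succ n =>
    rcases le_or_gt L 0 with hL | hL
    · have h0 : ∀ m : Fin 3 → Fin (2 ^ k), dyMode L k m = fun _ => 0 := fun m => by
        rw [dyMode, dyCell_eq_empty hL, Set.indicator_empty]
      simp [cohSum, occupation_succ, h0]
    have hG : ∀ m : Fin 3 → Fin (2 ^ k), Measurable fun Y : Config n =>
        ((‖((Real.sqrt ((L / 2 ^ k) ^ 3))⁻¹ : ℂ) *
          ∫ x in dyCell L k m, Ψ (Matrix.vecCons x Y)‖₊ : ℝ≥0∞) ^ 2) := fun m =>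
      (((measurable_setIntegral_vecCons hΨ _).const_mul _).nnnorm.coe_nnreal_ennreal).pow_const 2
    simp only [cohSum, occupation_succ, integral_conj_dyMode_mul]
    rw [← Finset.mul_sum, ← lintegral_finsetSum Finset.univ fun m _ => hG m, Nat.cast_succ,
      lintegral_nnnorm_sq_eq_lintegral_vecCons hΨ]
    exact mul_le_mul_right (lintegral_mono fun Y => sum_nnnorm_cellAverage_sq_le hL k hΨ Y) _

/-- **`F_k ∈ [0, 1]`.** For an admissible trial state (normalised, `C¹`) the dyadic coherent sum is at
most the particle number: `cohSum N L k Ψ ≤ N`. [folklore] -/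
theorem cohSum_le_card (L : ℝ) (k : ℕ) {N : ℕ} {L' : ℝ} (Ψ : TrialState N L') :
    cohSum N L k Ψ.ψ ≤ N := by
  simpa [Ψ.norm_eq] using cohSum_le_mul_lintegral L k Ψ.contDiff.continuous.measurable

end Bessel

end Literature.MathematicalPhysics.QuantumManyBody.BoseGas

end
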